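import Summits.QuantumAdvantage.QuantumAdvantage.Theorems.SosSandwichPseudoBoundedAAClassicalCorner
import HarnessLib

/-!
# Crux `PseudoBoundedAA` (stmt-QuantumAdvantage-15237, route SosSandwich) — the classical corner in the tree's
# randomized-query vocabulary: `PMF (DecisionTree N)` (as in `randQueryComplexity`)

File 2/2 of the CLASSICAL CORNER of PB-AA (file 1/2: `SosSandwichPseudoBoundedAAClassicalCorner.lean`, finite mixtures).
The tree models a randomized classical query algorithm as a probability distribution `μ : PMF (DecisionTree N)` over
deterministic decision trees (`Literature.Computability.Complexity.DecisionTree.randQueryComplexity`: "`∃ μ : PMF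
(DecisionTree n), (∀ T ∈ μ.support, T.depth ≤ d) ∧ …`"); its acceptance probability on input `x` is
`(μ.toOuterMeasure {t | t.eval x = true}).toReal`.  This file transports file 1 to that vocabulary:

* `finite_setOf_depth_le` — the decision trees of depth `≤ D` on `N` bits form a finite set (so a `PMF` supported on them
  is a finite mixture);
* `toReal_toOuterMeasure_eq_sum`, `sum_toReal_eq_one` — the acceptance probability as a finite weighted sum of tree outputs,
  weights `(μ t).toReal ≥ 0` summing to `1`;
* `exists_influence_ge_of_pmf` — **every randomized classical algorithm making at most `D` queries (all trees in the support
  of depth `≤ D`) whose acceptance probability is the cube restriction of `p` with `Var[p] > 0` has a variable with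
  `16·Var[p]² ≤ D²·Infⱼ[p]`**; `pseudoBounded_of_pmf` — such `p` lie in the sandwich class `K_D`;
* `pseudoBoundedAA_randomizedCorner` — the body of the route item `PseudoBoundedAA` in its literal inline vocabulary with the
  SOS hypothesis replaced by "acceptance probability of a `PMF` over trees of depth `≤ T`": `∃ i, 16 (ε/T)² ≤ Infᵢ[p]`,
  exponent pair `(2, 2)`, `C = 16`.

Honest label: vocabulary transport of a folklore-strength corner (two-function OSSS + averaging); no stub, crux or summit
is closed. Sources: O'Donnell–Saks–Schramm–Servedio, FOCS 2005, Thm 3.2; Aaronson–Ambainis arXiv:0911.0996, Conj. 6 /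
Thm 8 and the following remark; Buhrman–de Wolf 2002 §2.2 (randomized decision trees as distributions over trees).
-/

set_option linter.dupNamespace false

noncomputable section

namespace Summit.QuantumAdvantage.QuantumAdvantage.Theorems.SosSandwich

open Finset Function
open Literature.Computability.Complexity Literature.Computability.QuantumComplexity

namespace ClassicalCorner

variable {N : ℕ}

/-! ### Trees of bounded depth form a finite set -/

/-- The decision trees on `N` bits of depth at most `D` form a finite set (induction on `D`: a tree of depth `≤ D + 1` is
a leaf or a query node with two subtrees of depth `≤ D`). [cite: Wolf2002, §2.1] -/
theorem finite_setOf_depth_le (N D : ℕ) : Set.Finite {t : DecisionTree N | t.depth ≤ D} := by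
  induction D with
  | zero =>
    refine (Set.finite_range (fun b : Bool => (DecisionTree.leaf b : DecisionTree N))).subset ?_
    intro t ht
    cases t with
    | leaf b => exact ⟨b, rfl⟩
    | query i t₀ t₁ =>
      simp only [Set.mem_setOf_eq, DecisionTree.depth_query] at ht
      omega
  | succ D ih =>
    have hfin : Set.Finite (Set.range (fun b : Bool => (DecisionTree.leaf b : DecisionTree N)) ∪
        (fun q : Fin N × DecisionTree N × DecisionTree N => DecisionTree.query q.1 q.2.1 q.2.2) ''
          ((Set.univ : Set (Fin N)) ×ˢ ({t : DecisionTree N | t.depth ≤ D} ×ˢ {t : DecisionTree N | t.depth ≤ D}))) :=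
      (Set.finite_range _).union ((Set.finite_univ.prod (ih.prod ih)).image _)
    refine hfin.subset ?_
    intro t ht
    cases t with
    | leaf b => exact Or.inl ⟨b, rfl⟩
    | query i t₀ t₁ =>
      refine Or.inr ⟨(i, t₀, t₁), ?_, rfl⟩
      simp only [Set.mem_setOf_eq, DecisionTree.depth_query] at ht
      simp only [Set.mem_prod, Set.mem_univ, Set.mem_setOf_eq, true_and]
      constructor <;> omega

/-! ### The acceptance probability of a `PMF` over trees as a finite weighted sum -/

/-- If the support of `μ` is contained in the finset `S`, the acceptance probability of the randomized algorithm `μ` on `x`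
is the finite weighted sum `Σ_{t∈S} μ(t)·[t accepts x]`. [cite: Wolf2002, §2.2] -/
theorem toReal_toOuterMeasure_eq_sum (μ : PMF (DecisionTree N)) (S : Finset (DecisionTree N))
    (hS : ∀ t ∈ μ.support, t ∈ S) (x : Fin N → Bool) :
    (μ.toOuterMeasure {t | t.eval x = true}).toReal
      = ∑ t ∈ S, (μ t).toReal * (if t.eval x = true then (1 : ℝ) else 0) := by
  classical
  rw [PMF.toOuterMeasure_apply]
  have hzero : ∀ t ∉ S, ({t : DecisionTree N | t.eval x = true} : Set (DecisionTree N)).indicator (⇑μ) t = 0 := by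
    intro t ht
    have hμ : μ t = 0 := by
      by_contra h
      exact ht (hS t ((PMF.mem_support_iff μ t).mpr h))
    simp only [Set.indicator_apply, hμ, ite_self]
  rw [tsum_eq_sum (s := S) (fun t ht => hzero t ht)]
  rw [ENNReal.toReal_sum (fun t _ => ?_)]
  · refine Finset.sum_congr rfl fun t _ => ?_
    by_cases h : t.eval x = true
    · simp [h]
    · simp [h]
  · simp only [Set.indicator_apply]
    split_ifs
    · exact PMF.apply_ne_top μ t
    · exact ENNReal.zero_ne_top

/-- If the support of `μ` is contained in the finset `S`, the real weights `(μ t).toReal`, `t ∈ S`, sum to `1`.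
[cite: Wolf2002, §2.2] -/
theorem sum_toReal_eq_one {α : Type*} (μ : PMF α) (S : Finset α) (hS : ∀ t ∈ μ.support, t ∈ S) :
    ∑ t ∈ S, (μ t).toReal = 1 := by
  classical
  rw [← ENNReal.toReal_sum (fun t _ => PMF.apply_ne_top μ t)]
  have hzero : ∀ t ∉ S, μ t = 0 := by
    intro t ht
    by_contra h
    exact ht (hS t ((PMF.mem_support_iff μ t).mpr h))
  have h2 : ∑' t, μ t = ∑ t ∈ S, μ t := tsum_eq_sum (fun t ht => hzero t ht)
  have h1 : ∑ t ∈ S, μ t = 1 := by rw [← h2, PMF.tsum_coe]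
  rw [h1]
  simp

/-! ### Every randomized classical query algorithm has an influential variable -/

/-- **OSSS for randomized algorithms, `PMF` form.** If every tree in the support of `μ : PMF (DecisionTree N)` has depth
`≤ D` and the real polynomial `p` takes on the cube the acceptance probabilities of `μ`, then `Var[p] > 0` forces a
variable with `16·Var[p]² ≤ D²·Infⱼ[p]`. [cite: OdonnellEtAl2005, Thm 3.2]
[cite: AaronsonAmbainis2014, Thm 8 and the remark following it] -/
theorem exists_influence_ge_of_pmf (μ : PMF (DecisionTree N)) (D : ℕ) (hD : ∀ t ∈ μ.support, t.depth ≤ D)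
    (p : MvPolynomial (Fin N) ℝ)
    (hp : ∀ x, evalBool p x = (μ.toOuterMeasure {t | t.eval x = true}).toReal)
    (hv : 0 < boolVariance p) :
    ∃ j : Fin N, 16 * boolVariance p ^ 2 ≤ (D : ℝ) ^ 2 * influence j p := by
  classical
  set S : Finset (DecisionTree N) := (finite_setOf_depth_le N D).toFinset with hSdef
  have hS : ∀ t ∈ μ.support, t ∈ S := fun t ht => by
    rw [hSdef, Set.Finite.mem_toFinset]
    exact hD t ht
  have hSdepth : ∀ t ∈ S, t.depth ≤ D := fun t ht => by
    rw [hSdef, Set.Finite.mem_toFinset] at ht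
    exact ht
  exact exists_influence_ge_of_mixture_depth_le S (fun t => (μ t).toReal) (fun t _ => ENNReal.toReal_nonneg)
    (le_of_eq (sum_toReal_eq_one μ S hS)) id D hSdepth p
    (fun x => by rw [hp x, toReal_toOuterMeasure_eq_sum μ S hS x]; rfl) hv

/-- **Randomized algorithms land in the sandwich class.** If every tree in the support of `μ` has depth `≤ T` and `p` takes
on the cube the acceptance probabilities of `μ`, then `p ∈ K_T` (`PseudoBounded T p`).
[cite: KaniewskiLeeDewolf2015, Def. 7] [cite: Wolf2002, §2.2] -/
theorem pseudoBounded_of_pmf (μ : PMF (DecisionTree N)) (T : ℕ) (hT : ∀ t ∈ μ.support, t.depth ≤ T)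
    (p : MvPolynomial (Fin N) ℝ)
    (hp : ∀ x, evalBool p x = (μ.toOuterMeasure {t | t.eval x = true}).toReal) :
    PseudoBounded T p := by
  classical
  set S : Finset (DecisionTree N) := (finite_setOf_depth_le N T).toFinset with hSdef
  have hS : ∀ t ∈ μ.support, t ∈ S := fun t ht => by
    rw [hSdef, Set.Finite.mem_toFinset]
    exact hT t ht
  have hSdepth : ∀ t ∈ S, t.depth ≤ T := fun t ht => by
    rw [hSdef, Set.Finite.mem_toFinset] at ht
    exact ht
  refine pseudoBounded_of_mixture (ι := ↥S) (fun k => (μ k.1).toReal) (fun k => ENNReal.toReal_nonneg) ?_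
    (fun k => k.1) T (fun k => hSdepth k.1 k.2) p (fun x => ?_)
  · rw [Finset.sum_coe_sort S (fun t => (μ t).toReal)]
    exact sum_toReal_eq_one μ S hS
  · rw [hp x, toReal_toOuterMeasure_eq_sum μ S hS x,
      ← Finset.sum_coe_sort S (fun t => (μ t).toReal * (if t.eval x = true then (1 : ℝ) else 0))]

/-- **PB-AA ON THE RANDOMIZED-CLASSICAL CORNER, `PMF` form, exponent pair `(2, 2)`, `C = 16`.** In the literal inline
vocabulary of the route item `Theses.SosSandwich.PseudoBoundedAA`, with the SOS-sandwich hypothesis replaced by the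
STRONGER hypothesis "`p` is on the cube the acceptance probability of a randomized classical algorithm all of whose
deterministic runs make at most `T` queries" (`μ : PMF (DecisionTree N)` supported on trees of depth `≤ T`; such `p` lie in
`K_T` by `pseudoBounded_of_pmf`): `∃ i, 16·(ε/T)² ≤ Infᵢ[p]`. [cite: OdonnellEtAl2005, Thm 3.2]
[cite: AaronsonAmbainis2014, Conj. 6, Thm 8 and the remark following it] -/
theorem pseudoBoundedAA_randomizedCorner (N T : ℕ) (p : MvPolynomial (Fin N) ℝ) (ε : ℝ) :
    let ev : MvPolynomial (Fin N) ℝ → (Fin N → Bool) → ℝ :=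
      fun f x => MvPolynomial.eval (fun k => if x k then (1 : ℝ) else 0) f
    let avg : ((Fin N → Bool) → ℝ) → ℝ := fun g => (∑ x : Fin N → Bool, g x) / (2 : ℝ) ^ N
    1 ≤ T →
    (∃ μ : PMF (DecisionTree N), (∀ t ∈ μ.support, t.depth ≤ T) ∧
        ∀ x : Fin N → Bool, ev p x = (μ.toOuterMeasure {t | t.eval x = true}).toReal) →
    0 < ε → ε ≤ (avg fun x => (ev p x - avg (ev p)) ^ 2) →
    ∃ i : Fin N, 16 * (ε / T) ^ 2 ≤ (avg fun x => (ev p x - ev p (Function.update x i (!x i))) ^ 2) := by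
  intro ev avg hT hμ hε hεV
  obtain ⟨μ, hTd, hp⟩ := hμ
  have hp' : ∀ x, evalBool p x = (μ.toOuterMeasure {t | t.eval x = true}).toReal := hp
  have hεV' : ε ≤ boolVariance p := hεV
  have hv : 0 < boolVariance p := lt_of_lt_of_le hε hεV'
  obtain ⟨i, hi⟩ := exists_influence_ge_of_pmf μ T hTd p hp' hv
  refine ⟨i, ?_⟩
  change 16 * (ε / T) ^ 2 ≤ influence i p
  have hT0 : (0 : ℝ) < (T : ℝ) := by exact_mod_cast hT
  have hT2 : (0 : ℝ) < (T : ℝ) ^ 2 := by positivity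
  have hεsq : ε ^ 2 ≤ boolVariance p ^ 2 := pow_le_pow_left₀ hε.le hεV' 2
  rw [div_pow, mul_div_assoc', div_le_iff₀ hT2]
  calc 16 * ε ^ 2 ≤ 16 * boolVariance p ^ 2 := by linarith
    _ ≤ (T : ℝ) ^ 2 * influence i p := hi
    _ = influence i p * (T : ℝ) ^ 2 := mul_comm _ _

end ClassicalCorner

end Summit.QuantumAdvantage.QuantumAdvantage.Theorems.SosSandwich

end
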